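import Literature.Computability.Learning.LearnerLevel
import Literature.Computability.Learning.LearnerFP
import HarnessLib

/-!
# The budgets of the CIKK learner are subexponential

Analysis instalment (M9b-3) of the decomposition of the named fact
`Literature.Computability.Learning.cikk_natural_implies_learning` (CIKK 2016, Thm. 5.1): with the
good level `ℓg = goodLvl hU k₀ n a b` of `LearnerLevel.lean`, the coin budget
`coinLen n a b ℓg` and the round budget `tBudget` are `2^{O(s + ℓg)}` (`s = prmS n a b`), the good
level is `≤ ℓ₀(j) + 2^{(E(s)+j-1)/j}` for every `j ≥ 1` with `E` linear in `s`, and hence both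
budgets are subexponential in `n + ⌈1/ε⌉ + ⌈1/δ⌉` (`IsSubexpBudget`).

## References

* M. Carmosino, R. Impagliazzo, V. Kabanets, A. Kolokolova, *Learning algorithms from natural
  proofs*, CCC 2016, Thm. 5.1 and §5.1 (runtime regimes) [CarmosinoImpagliazzoKabanetsKolokolova2016].
-/

namespace Literature.Computability.Learning

open Literature.Computability.Complexity Literature.Computability.Complexity.DirectProduct
  Literature.Computability.MetaComplexity Literature.Computability.Cryptography _root_.Computability Finset Filter Polynomial

/-! ### Power-of-two bookkeeping -/

/-- `x ≤ 2^x`. [folklore] -/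
theorem le_two_pow_self (x : ℕ) : x ≤ 2 ^ x := Nat.lt_two_pow_self.le

/-- `n + 1 ≤ 2^s`. [folklore] -/
theorem succ_n_le_two_pow_prmS (n a b : ℕ) : n + 1 ≤ 2 ^ prmS n a b := by
  rw [prmS]; exact le_of_lt (lt_of_le_of_lt (by omega) (Nat.lt_size_self (n + a + b + 2)))

section Level

variable (n a b ℓ : ℕ)

/-- `κ ≤ 3s + ℓ + 31`. [folklore] -/
theorem prmKappa_le : prmKappa (prmS n a b) ℓ ≤ 3 * prmS n a b + ℓ + 31 := by
  rw [prmKappa]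
  have : Nat.size ℓ ≤ ℓ + 1 := Nat.size_le.2 (lt_of_lt_of_le Nat.lt_two_pow_self (Nat.pow_le_pow_right (by norm_num) (Nat.le_succ ℓ)))
  omega

/-- `k ≤ 2^{3s+ℓ+31}`. [folklore] -/
theorem lvlK_le_pow : lvlK n a b ℓ ≤ 2 ^ (3 * prmS n a b + ℓ + 31) := by
  rw [lvlK, prmK]; exact Nat.pow_le_pow_right (by norm_num) (prmKappa_le n a b ℓ)

/-- `k·n + k ≤ 2^{4s+ℓ+31}`. [folklore] -/
theorem lvlKn_le_pow : lvlK n a b ℓ * n + lvlK n a b ℓ ≤ 2 ^ (4 * prmS n a b + ℓ + 31) := by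
  have h1 := lvlK_le_pow n a b ℓ
  have h2 := succ_n_le_two_pow_prmS n a b
  calc lvlK n a b ℓ * n + lvlK n a b ℓ = lvlK n a b ℓ * (n + 1) := by ring
    _ ≤ 2 ^ (3 * prmS n a b + ℓ + 31) * 2 ^ prmS n a b := Nat.mul_le_mul h1 h2
    _ = 2 ^ (4 * prmS n a b + ℓ + 31) := by rw [← pow_add]; exact congrArg (fun e => 2 ^ e) (by omega)

/-- `q ≤ 2^{4s+ℓ+32}`. [folklore] -/
theorem lvlQ_le_pow : lvlQ n a b ℓ ≤ 2 ^ (4 * prmS n a b + ℓ + 32) := by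
  have h := prmQ_le (lvlK n a b ℓ * n + lvlK n a b ℓ) (Nat.add_pos_right _ (lvlK_pos n a b ℓ)).ne'
  calc lvlQ n a b ℓ = prmQ (lvlK n a b ℓ * n + lvlK n a b ℓ) := rfl
    _ ≤ 2 * (lvlK n a b ℓ * n + lvlK n a b ℓ) := h
    _ ≤ 2 * 2 ^ (4 * prmS n a b + ℓ + 31) := Nat.mul_le_mul_left _ (lvlKn_le_pow n a b ℓ)
    _ = 2 ^ (4 * prmS n a b + ℓ + 32) := by rw [← pow_succ']

/-- **The run length is `2^{O(s+ℓ)}`**: `lvlRunLen ≤ 2^{8s+5ℓ+88}`. [folklore] -/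
theorem lvlRunLen_le_pow : lvlRunLen n a b ℓ ≤ 2 ^ (8 * prmS n a b + 5 * ℓ + 88) := by
  obtain ⟨s, hs⟩ : ∃ s, prmS n a b = s := ⟨_, rfl⟩
  have hκ := prmKappa_le n a b ℓ
  have hK := lvlK_le_pow n a b ℓ
  have hKn := lvlKn_le_pow n a b ℓ
  have hq := lvlQ_le_pow n a b ℓ
  rw [hs] at hκ hK hKn hq
  have hkk : prmKK s ℓ ≤ 3 * s + 3 * ℓ + 39 := by rw [prmKK]; omega
  have hT : prmT s ℓ ≤ 2 ^ (4 * s + 4 * ℓ + 53) := by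
    rw [prmT]; exact Nat.pow_le_pow_right (by norm_num) (by omega)
  rw [lvlRunLen, runLen, offSt, offA, offPb, offSg, offSd, offW, stepLen, hs]
  generalize lvlK n a b ℓ = K at hK hKn ⊢
  generalize lvlQ n a b ℓ = q at hq ⊢
  generalize prmKK s ℓ = kk at hkk ⊢
  generalize prmT s ℓ = T at hT ⊢
  generalize prmKappa s ℓ = κ at hκ ⊢
  -- the big exponent
  obtain ⟨B, hB⟩ : ∃ B, 8 * s + 5 * ℓ + 85 = B := ⟨_, rfl⟩
  have two_le : ∀ {x e : ℕ}, x ≤ 2 ^ e → e ≤ B → x ≤ 2 ^ B := fun hx he => hx.trans (Nat.pow_le_pow_right (by norm_num) he)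
  have t1 : ℓ ≤ 2 ^ B := two_le (le_two_pow_self ℓ) (by omega)
  have t2 : q * q ≤ 2 ^ B := two_le (e := 2 * (4 * s + ℓ + 32))
    (by rw [two_mul, pow_add]; exact Nat.mul_le_mul hq hq) (by omega)
  have t3 : 2 ^ ℓ ≤ 2 ^ B := two_le le_rfl (by omega)
  have t4 : kk * K ≤ 2 ^ B := two_le (e := (3 * s + 3 * ℓ + 39) + (3 * s + ℓ + 31))
    (by rw [pow_add]; exact Nat.mul_le_mul (hkk.trans (le_two_pow_self _)) hK) (by omega)
  have t5 : kk ≤ 2 ^ B := two_le (hkk.trans (le_two_pow_self _)) (by omega)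
  have t6 : K ≤ 2 ^ B := two_le hK (by omega)
  have t7 : K * n ≤ 2 ^ B := two_le ((Nat.le_add_right _ _).trans hKn) (by omega)
  have t8 : T * (κ + K * n) ≤ 2 ^ B := by
    have hκK : κ + K * n ≤ 2 ^ (4 * s + ℓ + 32) := by
      have : κ ≤ 2 ^ (4 * s + ℓ + 31) := (le_two_pow_self κ).trans (Nat.pow_le_pow_right (by norm_num) (by omega))
      have h2 : K * n ≤ 2 ^ (4 * s + ℓ + 31) := (Nat.le_add_right _ _).trans hKn
      have h3 : 2 ^ (4 * s + ℓ + 32) = 2 ^ (4 * s + ℓ + 31) * 2 := by rw [← pow_succ]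
      omega
    exact two_le (e := (4 * s + 4 * ℓ + 53) + (4 * s + ℓ + 32)) (by rw [pow_add]; exact Nat.mul_le_mul hT hκK) (by omega)
  calc ℓ + q * q + 2 ^ ℓ + kk * K + kk + K + K * n + T * (κ + K * n) ≤ 8 * 2 ^ B := by
        generalize q * q = qq at t2 ⊢
        generalize kk * K = kkK at t4 ⊢
        generalize K * n = Kn at t7 t8 ⊢
        generalize T * (κ + Kn) = TT at t8 ⊢
        generalize 2 ^ ℓ = L at t3 ⊢
        generalize 2 ^ B = P at t1 t2 t3 t4 t5 t6 t7 t8 ⊢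
        omega
    _ = 2 ^ (8 * s + 5 * ℓ + 88) := by
        rw [show (8 : ℕ) = 2 ^ 3 by norm_num, ← pow_add]; exact congrArg (fun e => 2 ^ e) (by omega)

/-- **The block length is `2^{O(s+ℓ)}`**: `lvlBlockLen ≤ 2^{15(s+ℓ)+191}`. [folklore] -/
theorem lvlBlockLen_le_pow : lvlBlockLen n a b ℓ ≤ 2 ^ (15 * (prmS n a b + ℓ) + 191) := by
  obtain ⟨s, hs⟩ : ∃ s, prmS n a b = s := ⟨_, rfl⟩
  have hκ := prmKappa_le n a b ℓ
  have hRL := lvlRunLen_le_pow n a b ℓ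
  have hn := succ_n_le_two_pow_prmS n a b
  rw [hs] at hκ hRL hn
  have hReps : prmReps s ℓ ≤ 2 ^ (7 * s + 9 * ℓ + 102) := by
    rw [prmReps]; exact Nat.pow_le_pow_right (by norm_num) (by omega)
  have hM : prmM s ℓ * n ≤ 2 ^ (11 * s + 10 * ℓ + 116) := by
    rw [prmM]
    have h4 : (4 : ℕ) ^ s = 2 ^ (2 * s) := by rw [pow_mul]; norm_num
    have hlin : 2 * prmKappa s ℓ + 8 * ℓ + 2 * s + 48 ≤ 2 ^ (8 * s + 10 * ℓ + 110) :=
      (le_two_pow_self _).trans (Nat.pow_le_pow_right (by norm_num) (by omega))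
    calc 64 * 4 ^ s * (2 * prmKappa s ℓ + 8 * ℓ + 2 * s + 48) * n
        ≤ 2 ^ 6 * 2 ^ (2 * s) * 2 ^ (8 * s + 10 * ℓ + 110) * 2 ^ s := by
          rw [h4]; exact Nat.mul_le_mul (Nat.mul_le_mul_left _ hlin) ((Nat.le_succ n).trans hn)
      _ = 2 ^ (11 * s + 10 * ℓ + 116) := by
          rw [← pow_add, ← pow_add, ← pow_add]; exact congrArg (fun e => 2 ^ e) (by omega)
  rw [lvlBlockLen, hs]
  calc prmReps s ℓ * lvlRunLen n a b ℓ + prmM s ℓ * n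
      ≤ 2 ^ (7 * s + 9 * ℓ + 102) * 2 ^ (8 * s + 5 * ℓ + 88) + 2 ^ (11 * s + 10 * ℓ + 116) := add_le_add (Nat.mul_le_mul hReps hRL) hM
    _ ≤ 2 ^ (15 * (s + ℓ) + 190) + 2 ^ (15 * (s + ℓ) + 190) := by
        rw [← pow_add]
        exact add_le_add (Nat.pow_le_pow_right (by norm_num) (by omega)) (Nat.pow_le_pow_right (by norm_num) (by omega))
    _ = 2 ^ (15 * (s + ℓ) + 191) := by rw [← two_mul, ← pow_succ']

end Level

/-- **The coin budget is `2^{O(s+ℓg)}`**: `coinLen n a b ℓg ≤ 2^{16(s+ℓg)+192}`. [folklore] -/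
theorem coinLen_le_pow (n a b ℓg : ℕ) : coinLen n a b ℓg ≤ 2 ^ (16 * (prmS n a b + ℓg) + 192) := by
  rw [coinLen, lvlCoff]
  calc ∑ ℓ ∈ Finset.range (ℓg + 1), lvlBlockLen n a b ℓ ≤ ∑ _ℓ ∈ Finset.range (ℓg + 1), 2 ^ (15 * (prmS n a b + ℓg) + 191) :=
        Finset.sum_le_sum fun ℓ hℓ => (lvlBlockLen_le_pow n a b ℓ).trans
          (Nat.pow_le_pow_right (by norm_num) (by have := Finset.mem_range.1 hℓ; omega))
    _ = (ℓg + 1) * 2 ^ (15 * (prmS n a b + ℓg) + 191) := by rw [Finset.sum_const, Finset.card_range, smul_eq_mul]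
    _ ≤ 2 ^ (ℓg + 1) * 2 ^ (15 * (prmS n a b + ℓg) + 191) := Nat.mul_le_mul_right _ (le_two_pow_self _)
    _ ≤ 2 ^ (16 * (prmS n a b + ℓg) + 192) := by
        rw [← pow_add]; exact Nat.pow_le_pow_right (by norm_num) (by omega)

/-- **The round budget** of the learner: `qA(|⟨params, r⟩|) + 1` with `|r| = coinLen`. [folklore] -/
noncomputable def tBudgetOf (coins : ℕ → ℕ → ℕ → ℕ) (n a b : ℕ) : ℕ :=
  qA.eval (2 * (pacParams n a b).length + 2 + coins n a b) + 1

/-- `|pacParams n a b| = 2n + 2a + b + 4`. [folklore] -/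
theorem length_pacParams (n a b : ℕ) : (pacParams n a b).length = 2 * n + 2 * a + b + 4 := by
  rw [pacParams, unaryEncodeNat_eq_ones, unaryEncodeNat_eq_ones, unaryEncodeNat_eq_ones]
  simp only [length_boolPair, List.length_replicate]; ring

/-- **The round budget is `2^{O(s+ℓg)}`** whenever the coin budget is: from `coins ≤ 2^F` with
`16 s ≤ F`, `tBudgetOf coins ≤ 2^{4F+28}`. [folklore] -/
theorem tBudgetOf_le_pow {coins : ℕ → ℕ → ℕ → ℕ} {n a b F : ℕ} (hc : coins n a b ≤ 2 ^ F) (hF : 16 * prmS n a b ≤ F) :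
    tBudgetOf coins n a b ≤ 2 ^ (4 * F + 28) := by
  have hn : n + a + b + 2 < 2 ^ prmS n a b := by rw [prmS]; exact Nat.lt_size_self _
  have hs16 : 2 ^ prmS n a b ≤ 2 ^ F := Nat.pow_le_pow_right (by norm_num) (by omega)
  have hx : 2 * (pacParams n a b).length + 2 + coins n a b + 1 ≤ 2 ^ (F + 3) := by
    rw [length_pacParams, pow_add]
    have : 2 * (2 * n + 2 * a + b + 4) + 2 + 1 ≤ 7 * 2 ^ F := by omega
    omega
  rw [tBudgetOf, qA]
  simp only [eval_mul, eval_pow, eval_add, eval_X, eval_one, eval_ofNat]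
  calc 2 ^ 15 * (2 * (pacParams n a b).length + 2 + coins n a b + 1) ^ 4 + 1
      ≤ 2 ^ 15 * (2 ^ (F + 3)) ^ 4 + 2 ^ 15 * (2 ^ (F + 3)) ^ 4 :=
        add_le_add (Nat.mul_le_mul_left _ (Nat.pow_le_pow_left hx 4)) (Nat.one_le_iff_ne_zero.2 (by positivity))
    _ = 2 ^ (4 * F + 28) := by
        rw [← two_mul, ← pow_mul, ← pow_add, ← pow_succ']; exact congrArg (fun e => 2 ^ e) (by omega)

/-! ### The good level is small -/

/-- `2^x + 2^y ≤ 2^{x+y+1}`. [folklore] -/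
theorem two_pow_add_two_pow_le (x y : ℕ) : 2 ^ x + 2 ^ y ≤ 2 ^ (x + y + 1) := by
  have h1 : 2 ^ x ≤ 2 ^ (x + y) := Nat.pow_le_pow_right (by norm_num) (by omega)
  have h2 : 2 ^ y ≤ 2 ^ (x + y) := Nat.pow_le_pow_right (by norm_num) (by omega)
  rw [pow_succ]; omega

/-- `descBound n k₀ ≤ 2^{(2k₀+1)s+6}`. [folklore] -/
theorem descBound_le_pow (n a b k₀ : ℕ) : descBound n k₀ ≤ 2 ^ ((2 * k₀ + 1) * prmS n a b + 6) := by
  obtain ⟨s, hs⟩ : ∃ s, prmS n a b = s := ⟨_, rfl⟩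
  have hn : n ≤ 2 ^ s := by have := succ_n_le_two_pow_prmS n a b; rw [hs] at this; omega
  have hnk : n ^ k₀ ≤ 2 ^ (s * k₀) := by rw [pow_mul]; exact Nat.pow_le_pow_left hn _
  have h1 : n ^ k₀ + 1 ≤ 2 ^ (s * k₀ + 1) := by rw [pow_succ]; have := Nat.one_le_two_pow (n := s * k₀); omega
  have h2 : 8 * (n + n ^ k₀) + 10 ≤ 2 ^ (s + s * k₀ + 5) := by
    have h := two_pow_add_two_pow_le s (s * k₀)
    have h16 : 16 ≤ 2 ^ (s + s * k₀ + 4) := by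
      calc (16 : ℕ) = 2 ^ 4 := by norm_num
        _ ≤ 2 ^ (s + s * k₀ + 4) := Nat.pow_le_pow_right (by norm_num) (by omega)
    have : 2 ^ (s + s * k₀ + 5) = 2 ^ (s + s * k₀ + 1) * 8 + 2 ^ (s + s * k₀ + 4) := by
      rw [show s + s * k₀ + 5 = (s + s * k₀ + 1) + 4 by omega, pow_add, show s + s * k₀ + 4 = (s + s * k₀ + 1) + 3 by omega, pow_add]
      norm_num; ring
    omega
  rw [descBound, hs]
  calc (n ^ k₀ + 1) * (8 * (n + n ^ k₀) + 10) ≤ 2 ^ (s * k₀ + 1) * 2 ^ (s + s * k₀ + 5) := Nat.mul_le_mul h1 h2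
    _ = 2 ^ ((2 * k₀ + 1) * s + 6) := by rw [← pow_add]; exact congrArg (fun e => 2 ^ e) (by ring)

/-- `growA n a b k₀ ≤ 2^{(2k₀+8)s+67}`. [folklore] -/
theorem growA_le_pow (n a b k₀ : ℕ) : growA n a b k₀ ≤ 2 ^ ((2 * k₀ + 8) * prmS n a b + 67) := by
  obtain ⟨s, hs⟩ : ∃ s, prmS n a b = s := ⟨_, rfl⟩
  have hd := descBound_le_pow n a b k₀
  have hn := succ_n_le_two_pow_prmS n a b
  rw [hs] at hd hn
  have hK : kScale n a b = 2 ^ (3 * s + 31) := by rw [kScale, hs]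
  obtain ⟨E, hE⟩ : ∃ E, (2 * k₀ + 8) * s + 64 = E := ⟨_, rfl⟩
  have hsplit : (2 * k₀ + 8) * s = (2 * k₀ + 1) * s + 7 * s := by ring
  rw [hsplit] at hE
  have hEexp : (2 * k₀ + 1) * s + 6 ≤ E := by omega
  have hks : s ≤ (2 * k₀ + 1) * s := Nat.le_mul_of_pos_left _ (by omega)
  have t1 : 2 * descBound n k₀ ≤ 2 ^ E := by
    calc 2 * descBound n k₀ ≤ 2 * 2 ^ ((2 * k₀ + 1) * s + 6) := Nat.mul_le_mul_left _ hd
      _ = 2 ^ ((2 * k₀ + 1) * s + 7) := by rw [← pow_succ']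
      _ ≤ 2 ^ E := Nat.pow_le_pow_right (by norm_num) (by omega)
  have t2 : 2 * n + 19 ≤ 2 ^ E := by
    have : 2 * n + 19 ≤ 2 ^ (s + 1) + 2 ^ 5 := by rw [pow_succ]; norm_num; omega
    have h' := two_pow_add_two_pow_le (s + 1) 5
    exact this.trans (h'.trans (Nat.pow_le_pow_right (by norm_num) (by omega)))
  have t3 : 8 * kScale n a b * (n + 1) ≤ 2 ^ E := by
    rw [hK]
    calc 8 * 2 ^ (3 * s + 31) * (n + 1) ≤ 2 ^ 3 * 2 ^ (3 * s + 31) * 2 ^ s := Nat.mul_le_mul (by norm_num) hn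
      _ = 2 ^ (4 * s + 34) := by rw [← pow_add, ← pow_add]; exact congrArg (fun e => 2 ^ e) (by omega)
      _ ≤ 2 ^ E := Nat.pow_le_pow_right (by norm_num) (by omega)
  have t4 : 4 * kScale n a b ^ 2 * (n + 1) ^ 2 ≤ 2 ^ E := by
    rw [hK]
    calc 4 * (2 ^ (3 * s + 31)) ^ 2 * (n + 1) ^ 2 ≤ 2 ^ 2 * (2 ^ (3 * s + 31)) ^ 2 * (2 ^ s) ^ 2 :=
          Nat.mul_le_mul (by norm_num) (Nat.pow_le_pow_left hn 2)
      _ = 2 ^ (8 * s + 64) := by rw [← pow_mul, ← pow_mul, ← pow_add, ← pow_add]; exact congrArg (fun e => 2 ^ e) (by omega)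
      _ ≤ 2 ^ E := Nat.pow_le_pow_right (by norm_num) (by omega)
  rw [growA, hs]
  calc 2 * descBound n k₀ + 2 * n + 19 + 8 * kScale n a b * (n + 1) + 4 * kScale n a b ^ 2 * (n + 1) ^ 2 ≤ 4 * 2 ^ E := by
        generalize 8 * kScale n a b * (n + 1) = x3 at t3 ⊢
        generalize 4 * kScale n a b ^ 2 * (n + 1) ^ 2 = x4 at t4 ⊢
        generalize 2 ^ E = P at t1 t2 t3 t4 ⊢
        omega
    _ = 2 ^ (E + 2) := by rw [pow_add]; norm_num; ring
    _ ≤ 2 ^ ((2 * k₀ + 8) * s + 67) := Nat.pow_le_pow_right (by norm_num) (by rw [hsplit]; omega)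

/-- **The exponent `E(s)`** with `A'·4^{deg Q} ≤ 2^{E(s)}`, linear in `s`. [folklore] -/
noncomputable def gExp (k₀ s : ℕ) : ℕ := T5Q.natDegree * ((2 * k₀ + 8) * s + 67) + Nat.size (T5Q.eval 1) + 2 * T5Q.natDegree

/-- `A'·4^{deg Q} ≤ 2^{E(s)}`. [folklore] -/
theorem growA'_mul_le (n a b k₀ : ℕ) : growA' n a b k₀ * 4 ^ T5Q.natDegree ≤ 2 ^ gExp k₀ (prmS n a b) := by
  rw [growA', gExp, pow_add, pow_add]
  have h1 : T5Q.eval 1 ≤ 2 ^ Nat.size (T5Q.eval 1) := (Nat.lt_size_self _).le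
  have h2 : growA n a b k₀ ^ T5Q.natDegree ≤ 2 ^ (T5Q.natDegree * ((2 * k₀ + 8) * prmS n a b + 67)) := by
    rw [mul_comm (T5Q.natDegree), pow_mul]; exact Nat.pow_le_pow_left (growA_le_pow n a b k₀) _
  have h3 : (4 : ℕ) ^ T5Q.natDegree = 2 ^ (2 * T5Q.natDegree) := by rw [pow_mul]; norm_num
  rw [h3]
  calc T5Q.eval 1 * growA n a b k₀ ^ T5Q.natDegree * 2 ^ (2 * T5Q.natDegree)
      ≤ 2 ^ Nat.size (T5Q.eval 1) * 2 ^ (T5Q.natDegree * ((2 * k₀ + 8) * prmS n a b + 67)) * 2 ^ (2 * T5Q.natDegree) :=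
        Nat.mul_le_mul_right _ (Nat.mul_le_mul h1 h2)
    _ = 2 ^ (T5Q.natDegree * ((2 * k₀ + 8) * prmS n a b + 67)) * 2 ^ Nat.size (T5Q.eval 1) * 2 ^ (2 * T5Q.natDegree) := by ring

/-- **The good level is small**: `ℓg ≤ ℓ₀(j) + 2^{⌈E(s)/j⌉}` for every `j ≥ 1`.
[cite: CarmosinoImpagliazzoKabanetsKolokolova2016, Thm. 5.1 with §5.1] -/
theorem goodLvl_le_pow {R : CombinatorialProperty} (hU : IsUsefulAgainstPPoly R) (k₀ : ℕ) {j : ℕ} (hj : 1 ≤ j) :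
    ∃ ℓ₀, ∀ n a b, goodLvl hU k₀ n a b ≤ ℓ₀ + 2 ^ ((gExp k₀ (prmS n a b) + j - 1) / j) := by
  obtain ⟨ℓ₀, hℓ₀⟩ := goodLevel_of_large hU k₀ j
  refine ⟨ℓ₀, fun n a b => goodLvl_le hU k₀ n a b (hℓ₀ n a b _ (Nat.le_add_right _ _) ?_)⟩
  set c := (gExp k₀ (prmS n a b) + j - 1) / j with hc
  have hcj : gExp k₀ (prmS n a b) ≤ j * c := by
    rw [hc]
    have := Nat.div_add_mod (gExp k₀ (prmS n a b) + j - 1) j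
    have := Nat.mod_lt (gExp k₀ (prmS n a b) + j - 1) (by omega : 0 < j)
    -- `j * ⌈E/j⌉ ≥ E`
    have hpos : 0 < j := by omega
    calc gExp k₀ (prmS n a b) ≤ (gExp k₀ (prmS n a b) + j - 1) - (gExp k₀ (prmS n a b) + j - 1) % j := by omega
      _ = j * ((gExp k₀ (prmS n a b) + j - 1) / j) := by
          have := Nat.div_add_mod (gExp k₀ (prmS n a b) + j - 1) j; omega
  calc growA' n a b k₀ * 4 ^ T5Q.natDegree ≤ 2 ^ gExp k₀ (prmS n a b) := growA'_mul_le n a b k₀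
    _ ≤ 2 ^ (j * c) := Nat.pow_le_pow_right (by norm_num) hcj
    _ = (2 ^ c) ^ j := by rw [mul_comm, pow_mul]
    _ ≤ (ℓ₀ + 2 ^ c) ^ j := Nat.pow_le_pow_left (Nat.le_add_left _ _) _

/-! ### Subexponential budgets -/

/-- **Polynomial domination**: for `0 < θ < γ`, `C₁ + C₂ N^θ ≤ N^γ` for all large `N`. [folklore] -/
theorem exists_nat_rpow_dominates {θ γ C₁ C₂ : ℝ} (hθ : 0 < θ) (hθγ : θ < γ) (h1 : 0 ≤ C₁) (h2 : 0 ≤ C₂) :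
    ∃ N₀ : ℕ, ∀ N : ℕ, N₀ ≤ N → C₁ + C₂ * (N : ℝ) ^ θ ≤ (N : ℝ) ^ γ := by
  obtain ⟨N₀, hN₀⟩ : ∃ N₀ : ℕ, ((C₁ + C₂ + 1) ^ (1 / (γ - θ)) : ℝ) ≤ N₀ := exists_nat_ge _
  refine ⟨max N₀ 1, fun N hN => ?_⟩
  have hN1 : (1 : ℝ) ≤ N := by exact_mod_cast le_of_max_le_right hN
  have hNpos : (0 : ℝ) < N := by linarith
  have hgap : 0 < γ - θ := by linarith
  have hbase : C₁ + C₂ + 1 ≤ (N : ℝ) ^ (γ - θ) := by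
    have hN' : ((C₁ + C₂ + 1) ^ (1 / (γ - θ)) : ℝ) ≤ N := hN₀.trans (by exact_mod_cast le_of_max_le_left hN)
    calc C₁ + C₂ + 1 = (((C₁ + C₂ + 1) ^ (1 / (γ - θ))) ^ (γ - θ) : ℝ) := by
          rw [← Real.rpow_mul (by linarith), one_div_mul_cancel hgap.ne', Real.rpow_one]
      _ ≤ (N : ℝ) ^ (γ - θ) := Real.rpow_le_rpow (by positivity) hN' hgap.le
  have hθ1 : (1 : ℝ) ≤ (N : ℝ) ^ θ := Real.one_le_rpow hN1 hθ.le
  have hθ0 : (0 : ℝ) ≤ (N : ℝ) ^ θ := by linarith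
  calc C₁ + C₂ * (N : ℝ) ^ θ ≤ (C₁ + C₂) * (N : ℝ) ^ θ := by nlinarith
    _ ≤ (N : ℝ) ^ (γ - θ) * (N : ℝ) ^ θ := mul_le_mul_of_nonneg_right (by linarith) hθ0
    _ = (N : ℝ) ^ γ := by rw [← Real.rpow_add hNpos, sub_add_cancel]

/-- `2^{size x} ≤ 2x` for `x ≥ 1`. (Cf. the `≤ 2x+1` variants `two_pow_size_le` in
FineGrained/APSPToMinPlusProduct.lean and Barriers/CriticalPhenomena; not imported to keep this file light.) [folklore] -/
theorem two_pow_size_le {x : ℕ} (hx : 1 ≤ x) : 2 ^ Nat.size x ≤ 2 * x := by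
  have hsz : 0 < Nat.size x := Nat.size_pos.2 hx
  have hge : 2 ^ (Nat.size x - 1) ≤ x := by
    by_contra hc
    have := (Nat.size_le).2 (not_le.1 hc)
    omega
  have heq : 2 ^ Nat.size x = 2 ^ (Nat.size x - 1) * 2 := by
    rw [← pow_succ]; exact congrArg (fun e => 2 ^ e) (by omega)
  rw [heq]; omega

/-- `2^s ≤ 2N + 4` as reals (`s = prmS n a b`, `N = n + a + b`). [folklore] -/
theorem two_rpow_prmS_le (n a b : ℕ) : (2 : ℝ) ^ (prmS n a b : ℝ) ≤ 2 * (n + a + b : ℕ) + 4 := by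
  have h := two_pow_size_le (x := n + a + b + 2) (by omega)
  rw [← prmS] at h
  rw [Real.rpow_natCast]
  have : ((2 ^ prmS n a b : ℕ) : ℝ) ≤ ((2 * (n + a + b + 2) : ℕ) : ℝ) := by exact_mod_cast h
  push_cast at this ⊢
  linarith

/-- `s ≤ x^θ/(θ log 2)` with `x = 2N + 4`. [folklore] -/
theorem prmS_le_rpow (n a b : ℕ) {θ : ℝ} (hθ : 0 < θ) :
    (prmS n a b : ℝ) ≤ (2 * (n + a + b : ℕ) + 4 : ℝ) ^ θ / θ / Real.log 2 := by
  have hx : (0 : ℝ) < 2 * (n + a + b : ℕ) + 4 := by positivity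
  have h2 := two_rpow_prmS_le n a b
  have hlog2 : 0 < Real.log 2 := Real.log_pos (by norm_num)
  have hs : (prmS n a b : ℝ) * Real.log 2 ≤ Real.log (2 * (n + a + b : ℕ) + 4) := by
    rw [← Real.log_rpow (by norm_num : (0:ℝ) < 2)]
    exact Real.log_le_log (by positivity) h2
  have hl := Real.log_le_rpow_div hx.le hθ
  rw [le_div_iff₀ hlog2]
  exact hs.trans hl

/-- **Budgets of size `2^{O(s + ℓg)}` are subexponential.** [cite: CarmosinoImpagliazzoKabanetsKolokolova2016, Thm. 5.1 with §5.1] -/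
theorem isSubexpBudget_of_le {R : CombinatorialProperty} (hU : IsUsefulAgainstPPoly R) (k₀ : ℕ) {B : ℕ → ℕ → ℕ → ℕ} (c d : ℕ)
    (hB : ∀ n a b, B n a b ≤ 2 ^ (c * (prmS n a b + goodLvl hU k₀ n a b) + d)) : IsSubexpBudget B := by
  intro γ hγ
  -- the constants
  set D := T5Q.natDegree with hD
  set α : ℕ := D * (2 * k₀ + 8) with hα
  set β : ℕ := D * 67 + Nat.size (T5Q.eval 1) + 2 * D with hβ
  have hE : ∀ s, gExp k₀ s = α * s + β := fun s => by rw [gExp, hα, hβ, ← hD]; ring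
  set θ : ℝ := γ / 4 with hθ
  have hθpos : 0 < θ := by positivity
  have hθγ : θ < γ := by rw [hθ]; linarith
  -- choose `j > 4α/γ`, so that `α/j ≤ θ`
  obtain ⟨j, hj⟩ : ∃ j : ℕ, (α : ℝ) / θ < j := exists_nat_gt _
  have hj1 : 1 ≤ j := by
    have : (0 : ℝ) < j := lt_of_le_of_lt (by positivity) hj
    exact_mod_cast this
  have hjpos : (0 : ℝ) < j := by exact_mod_cast hj1
  have hαj : (α : ℝ) / j ≤ θ := by
    rw [div_le_iff₀ hjpos]; rw [div_lt_iff₀ hθpos] at hj; linarith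
  obtain ⟨ℓ₀, hℓ₀⟩ := goodLvl_le_pow hU k₀ hj1
  -- the exponent bound `e ≤ C₁ + C₂ x^θ`, `x = 2N+4`
  set C₁ : ℝ := c * ℓ₀ + d with hC₁
  set C₂ : ℝ := c / θ / Real.log 2 + c * (2 * (2 : ℝ) ^ ((β : ℝ) / j)) with hC₂
  have hlog2 : 0 < Real.log 2 := Real.log_pos (by norm_num)
  have hC₁0 : 0 ≤ C₁ := by positivity
  have hC₂0 : 0 ≤ C₂ := by positivity
  have hexp : ∀ n a b, ((c * (prmS n a b + goodLvl hU k₀ n a b) + d : ℕ) : ℝ) ≤ C₁ + C₂ * (2 * (n + a + b : ℕ) + 4 : ℝ) ^ θ := by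
    intro n a b
    set x : ℝ := 2 * (n + a + b : ℕ) + 4 with hx
    have hx1 : (1 : ℝ) ≤ x := by rw [hx]; have : (0:ℝ) ≤ (n + a + b : ℕ) := Nat.cast_nonneg _; linarith
    have hs := prmS_le_rpow n a b hθpos
    rw [← hx] at hs
    have hℓ := hℓ₀ n a b
    -- `2^{⌈E/j⌉} ≤ 2 · 2^{β/j} · x^θ`
    have hpow : ((2 ^ ((gExp k₀ (prmS n a b) + j - 1) / j) : ℕ) : ℝ) ≤ 2 * (2 : ℝ) ^ ((β : ℝ) / j) * x ^ θ := by
      have hdiv : (gExp k₀ (prmS n a b) + j - 1) / j ≤ gExp k₀ (prmS n a b) / j + 1 := by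
        calc (gExp k₀ (prmS n a b) + j - 1) / j ≤ (gExp k₀ (prmS n a b) + j) / j := Nat.div_le_div_right (by omega)
          _ = gExp k₀ (prmS n a b) / j + 1 := Nat.add_div_right _ (by omega)
      have h1 : ((2 ^ ((gExp k₀ (prmS n a b) + j - 1) / j) : ℕ) : ℝ) ≤ 2 * (2 : ℝ) ^ ((gExp k₀ (prmS n a b) / j : ℕ) : ℝ) := by
        have : 2 ^ ((gExp k₀ (prmS n a b) + j - 1) / j) ≤ 2 ^ (gExp k₀ (prmS n a b) / j + 1) := Nat.pow_le_pow_right (by norm_num) hdiv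
        have h' : ((2 ^ ((gExp k₀ (prmS n a b) + j - 1) / j) : ℕ) : ℝ) ≤ ((2 ^ (gExp k₀ (prmS n a b) / j + 1) : ℕ) : ℝ) := by exact_mod_cast this
        refine h'.trans (le_of_eq ?_)
        rw [Real.rpow_natCast]; push_cast; ring
      have h2 : ((gExp k₀ (prmS n a b) / j : ℕ) : ℝ) ≤ (α : ℝ) * prmS n a b / j + β / j := by
        calc ((gExp k₀ (prmS n a b) / j : ℕ) : ℝ) ≤ (gExp k₀ (prmS n a b) : ℝ) / j := Nat.cast_div_le
          _ = (α : ℝ) * prmS n a b / j + β / j := by rw [hE]; push_cast; ring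
      have h3 : (2 : ℝ) ^ ((gExp k₀ (prmS n a b) / j : ℕ) : ℝ) ≤ (2 : ℝ) ^ ((α : ℝ) * prmS n a b / j + β / j) :=
        Real.rpow_le_rpow_of_exponent_le (by norm_num) h2
      have h4 : (2 : ℝ) ^ ((α : ℝ) * prmS n a b / j + β / j) = (2 : ℝ) ^ ((β : ℝ) / j) * ((2 : ℝ) ^ (prmS n a b : ℝ)) ^ ((α : ℝ) / j) := by
        rw [Real.rpow_add (by norm_num), ← Real.rpow_mul (by norm_num), mul_comm]
        congr 1; congr 1; ring
      have h5 : ((2 : ℝ) ^ (prmS n a b : ℝ)) ^ ((α : ℝ) / j) ≤ x ^ ((α : ℝ) / j) :=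
        Real.rpow_le_rpow (by positivity) (by rw [hx]; exact two_rpow_prmS_le n a b) (by positivity)
      have h6 : x ^ ((α : ℝ) / j) ≤ x ^ θ := Real.rpow_le_rpow_of_exponent_le hx1 hαj
      have h22 : (0 : ℝ) ≤ 2 * (2 : ℝ) ^ ((β : ℝ) / j) := by positivity
      calc ((2 ^ ((gExp k₀ (prmS n a b) + j - 1) / j) : ℕ) : ℝ) ≤ 2 * (2 : ℝ) ^ ((gExp k₀ (prmS n a b) / j : ℕ) : ℝ) := h1
        _ ≤ 2 * ((2 : ℝ) ^ ((β : ℝ) / j) * ((2 : ℝ) ^ (prmS n a b : ℝ)) ^ ((α : ℝ) / j)) := by rw [← h4]; linarith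
        _ ≤ 2 * (2 : ℝ) ^ ((β : ℝ) / j) * x ^ θ := by rw [mul_assoc]; exact mul_le_mul_of_nonneg_left (mul_le_mul_of_nonneg_left (h5.trans h6) (by positivity)) (by norm_num)
    have hℓR : (goodLvl hU k₀ n a b : ℝ) ≤ ℓ₀ + 2 * (2 : ℝ) ^ ((β : ℝ) / j) * x ^ θ := by
      have : (goodLvl hU k₀ n a b : ℝ) ≤ ((ℓ₀ + 2 ^ ((gExp k₀ (prmS n a b) + j - 1) / j) : ℕ) : ℝ) := by exact_mod_cast hℓ
      rw [Nat.cast_add] at this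
      linarith
    have hc0 : (0 : ℝ) ≤ c := Nat.cast_nonneg _
    have hxθ : (0 : ℝ) ≤ x ^ θ := by positivity
    push_cast
    rw [hC₁, hC₂]
    have e1 : (c : ℝ) * prmS n a b ≤ c / θ / Real.log 2 * x ^ θ := by
      calc (c : ℝ) * prmS n a b ≤ c * (x ^ θ / θ / Real.log 2) := mul_le_mul_of_nonneg_left hs hc0
        _ = c / θ / Real.log 2 * x ^ θ := by ring
    have e2 : (c : ℝ) * goodLvl hU k₀ n a b ≤ c * ℓ₀ + c * (2 * (2 : ℝ) ^ ((β : ℝ) / j)) * x ^ θ := by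
      calc (c : ℝ) * goodLvl hU k₀ n a b ≤ c * (ℓ₀ + 2 * (2 : ℝ) ^ ((β : ℝ) / j) * x ^ θ) := mul_le_mul_of_nonneg_left hℓR hc0
        _ = c * ℓ₀ + c * (2 * (2 : ℝ) ^ ((β : ℝ) / j)) * x ^ θ := by ring
    nlinarith [e1, e2]
  -- `x^θ ≤ 6^θ N^θ` and domination
  obtain ⟨N₀, hN₀⟩ := exists_nat_rpow_dominates hθpos hθγ hC₁0 (mul_nonneg hC₂0 (Real.rpow_nonneg (by norm_num : (0:ℝ) ≤ 6) θ))
  refine ⟨max N₀ 1, fun n a b hN => ?_⟩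
  have hN1 : 1 ≤ n + a + b := le_of_max_le_right hN
  have hNR : (1 : ℝ) ≤ (n + a + b : ℕ) := by exact_mod_cast hN1
  have hdom := hN₀ (n + a + b) (le_of_max_le_left hN)
  have hx6 : (2 * (n + a + b : ℕ) + 4 : ℝ) ^ θ ≤ (6 : ℝ) ^ θ * ((n + a + b : ℕ) : ℝ) ^ θ := by
    rw [← Real.mul_rpow (by norm_num) (by positivity)]
    exact Real.rpow_le_rpow (by positivity) (by linarith) hθpos.le
  have he := hexp n a b
  have hfin : ((c * (prmS n a b + goodLvl hU k₀ n a b) + d : ℕ) : ℝ) ≤ ((n + a + b : ℕ) : ℝ) ^ γ := by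
    refine he.trans (le_trans ?_ hdom)
    have := mul_le_mul_of_nonneg_left hx6 hC₂0
    linarith
  calc (B n a b : ℝ) ≤ ((2 ^ (c * (prmS n a b + goodLvl hU k₀ n a b) + d) : ℕ) : ℝ) := by exact_mod_cast hB n a b
    _ = (2 : ℝ) ^ ((c * (prmS n a b + goodLvl hU k₀ n a b) + d : ℕ) : ℝ) := by rw [Real.rpow_natCast]; push_cast; ring
    _ ≤ (2 : ℝ) ^ ((n + a + b : ℝ) ^ γ) := by
        refine Real.rpow_le_rpow_of_exponent_le (by norm_num) ?_
        have : ((n + a + b : ℕ) : ℝ) = (n + a + b : ℝ) := by push_cast; ring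
        rw [← this]; exact hfin

end Literature.Computability.Learning
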